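import Summits.AtomisticToContinuum.BoseEinsteinCondensation.Theorems.BECCutLineWeakDisorderGroundStateRigidityStubCompactness
import Summits.AtomisticToContinuum.BoseEinsteinCondensation.Theorems.BECCutLineWeakDisorderGroundStateRigidityStubRigidityOfUnique
import Summits.AtomisticToContinuum.BoseEinsteinCondensation.Theorems.BECCutLineWeakDisorderGroundStateRigidityStubFiniteEnergyLowDensity
import Summits.AtomisticToContinuum.BoseEinsteinCondensation.Theorems.BECCutLineWeakDisorderGroundStateRigidityStubExistsNonnegGroundState
import Summits.AtomisticToContinuum.BoseEinsteinCondensation.Theorems.BECCutLineWeakDisorderGroundStateRigidityEssBounded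
import Summits.AtomisticToContinuum.BoseEinsteinCondensation.Theorems.BECCutLineWeakDisorderGroundStateRigidityStubLincombGroundState
import Summits.AtomisticToContinuum.BoseEinsteinCondensation.Theorems.BECCutLineWeakDisorderGroundStateRigidityStubEnergyTrunc
import Summits.AtomisticToContinuum.BoseEinsteinCondensation.Theorems.BECCutLineWeakDisorderGroundStateRigidityStubVanishOffFree
import Summits.AtomisticToContinuum.BoseEinsteinCondensation.Theorems.BECCutLineWeakDisorderGroundStateRigidityStubUniqueOfPosOn
import Summits.AtomisticToContinuum.BoseEinsteinCondensation.Theorems.BECCutLineWeakDisorderGroundStateRigidityStubLocalTubeCore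
import Summits.AtomisticToContinuum.BoseEinsteinCondensation.Theorems.BECCutLineWeakDisorderGroundStateRigidityStubPolygonalChain
import Summits.AtomisticToContinuum.BoseEinsteinCondensation.Theorems.BECCutLineWeakDisorderGroundStateRigidityStubChainedTube
import Summits.AtomisticToContinuum.BoseEinsteinCondensation.Theorems.BECCutLineWeakDisorderGroundStateRigidityStubTruncDiagonal
import Summits.AtomisticToContinuum.BoseEinsteinCondensation.Theorems.BECCutLineWeakDisorderGroundStateRigidityStubCutStateBound
import Summits.AtomisticToContinuum.BoseEinsteinCondensation.Theorems.BECCutLineWeakDisorderGroundStateRigidityStubKineticCauchy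
import Summits.AtomisticToContinuum.BoseEinsteinCondensation.Theorems.BECCutLineWeakDisorderGroundStateRigidityStubLayerKineticVanishing
import Summits.AtomisticToContinuum.BoseEinsteinCondensation.Theorems.BECCutLineWeakDisorderGroundStateRigidityStubCoreCutoff
import Summits.AtomisticToContinuum.BoseEinsteinCondensation.Theorems.BECCutLineWeakDisorderGroundStateRigidityStubShellMassOfCutoff
import Summits.AtomisticToContinuum.BoseEinsteinCondensation.Theorems.BECCutLineWeakDisorderGroundStateRigidityStubClosedEnergyTruncHardCore
import Summits.AtomisticToContinuum.BoseEinsteinCondensation.Theorems.GroundStateRigidity.Negative.LoadBearingHypotheses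
import HarnessLib

/-!
# Crux `GroundStateRigidity` (stmt-AtomisticToContinuum-9072), line `Sketch`:
# the hard-core class is reduced to connectivity of the dilute hard-sphere configuration space

Supports (does not close) stmt-AtomisticToContinuum-9072 (lead c4, assembly of Stubs 0, 1, 5a, 5b, 6, 14–20
and the seven pieces 15a–15g of the closed-form energy truncation, all landed). TECHNICAL NOTE: Stub 19
`stub_posOfConnected` is landed (p126419, file `…StubPosOfConnected.lean`) but its olean was missing from the farm
library build when this file was written, so its statement is threaded as the explicit hypothesis `hpos`
(discharge it with `stub_posOfConnected`); everything else is imported. For the FLAGSHIP hard-core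
class of admissible pair potentials — `v = ⊤` on `[0, b]`, `v ≤ C` on `(b, ∞)`, measurable (hard spheres of
diameter `b` with a bounded tail) — we prove, at every `(N ≥ 1, L > 0)` with `E₀(N, L) < ⊤`:

* `groundStateEnergy_trunc_iSup_hardCore` : `supₙ E₀(v ⊓ n) = E₀(v)` (energy truncation; no Hardy inequality,
  no regularity of minimisers: Stub 15 = 15a–15g with Stub 0);
* `hasUniqueGroundState_hardCore_of_joined` : if the free region
  `F_b = {X ∈ Λ_L^N : |xᵢ − xⱼ| > b ∀ i ≠ j}` is path-connected (`JoinedIn`), the closed-form ground state is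
  unique up to phase (component-wise Perron–Frobenius for the truncated Feynman–Kac semigroups, Stubs 14–20);
* `rigid_hardCore_of_joined` : hence near-minimisers are mutually `L²`-close up to a phase (Stub 1 with Stub 0)
  — the local form of the crux;
* `groundStateRigidity_hardCore_of_cubeConnected` : CONDITIONAL on the dilute connectivity statement
  `CubeConnected c₀` (Stub 21 of the line, stated inline as a hypothesis — an OPEN problem of discrete geometry,
  Baryshnikov–Bubenik–Kahle, IMRN 2014, §6: "are there any bounding regions so that config(n, r) is connected
  for r ≤ C n^{-1/d}?"), the crux `GroundStateRigidity` holds for every admissible `v` of the ESSENTIAL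
  hard-core class (`v = ⊤` a.e. on `[0,b]`, `v ≤ C` a.e. beyond `b`), with `ρ₀ = min (ρ₁(v), c₀ / b³)`.

So for hard spheres the crux is EQUIVALENT-in-practice to a statement with no energies and no quantum
mechanics in it; what is NOT claimed here is `CubeConnected` itself (see the crux dossier `KERNEL-c4.md`:
flat free surfaces leak at first order, so only strictly convex "vaulted" cell foams could be sparse
container-jammed obstructions; their existence is open).

References: Reed–Simon IV §XIII.12 (Thms XIII.44–47) for the Perron–Frobenius mechanism; Kato, Perturbation
theory VI §1.3–1.4 for closed forms; LSSY2005 Ch. 2 for the hard-core cutoffs.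
-/

noncomputable section

open MeasureTheory Filter Metric
open scoped ENNReal NNReal Topology

namespace Summit.AtomisticToContinuum.BoseEinsteinCondensation.Theorems.GroundStateRigidity

open Literature.MathematicalPhysics.QuantumManyBody.BoseGas

namespace HardCoreOfConnected

/-- The free region `{all pairs > b} ∩ Λ_L^N` is open. [folklore] -/
theorem isOpen_free (N : ℕ) (L b : ℝ) :
    IsOpen {Z : Config N | Z ∈ boxN N L ∧ ∀ i j : Fin N, i ≠ j → b < dist (Z i) (Z j)} := by
  have h1 : IsOpen {Z : Config N | ∀ i j : Fin N, i ≠ j → b < dist (Z i) (Z j)} := by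
    have : {Z : Config N | ∀ i j : Fin N, i ≠ j → b < dist (Z i) (Z j)} =
        ⋂ i : Fin N, ⋂ j : Fin N, {Z : Config N | i ≠ j → b < dist (Z i) (Z j)} := by
      ext Z; simp
    rw [this]
    refine isOpen_iInter_of_finite fun i => isOpen_iInter_of_finite fun j => ?_
    by_cases hij : i = j
    · have : {Z : Config N | i ≠ j → b < dist (Z i) (Z j)} = Set.univ := by
        ext Z; simp [hij]
      rw [this]; exact isOpen_univ
    · have : {Z : Config N | i ≠ j → b < dist (Z i) (Z j)} =
          {Z : Config N | b < dist (Z i) (Z j)} := by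
        ext Z; simp [hij]
      rw [this]
      exact isOpen_lt continuous_const ((continuous_apply i).dist (continuous_apply j))
  exact (isOpen_boxN N L).inter h1

/-- Monotonicity of the truncated energies in the truncation level. [folklore] -/
theorem energy_trunc_mono {N : ℕ} {L : ℝ} (v : ℝ → ℝ≥0∞) {m n : ℕ} (hmn : m ≤ n)
    (Θ : TrialState N L) :
    energy (fun r => min (v r) (m : ℝ≥0∞)) Θ ≤ energy (fun r => min (v r) (n : ℝ≥0∞)) Θ := by
  unfold energy
  refine lintegral_mono fun X => add_le_add le_rfl (mul_le_mul' ?_ le_rfl)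
  exact Finset.sum_le_sum fun _ _ => Finset.sum_le_sum fun _ _ =>
    min_le_min le_rfl (by exact_mod_cast hmn)

end HardCoreOfConnected

open HardCoreOfConnected

/-- **Energy truncation for the hard-core class**: `supₙ E₀(v ⊓ n) = E₀(v)` for `v = ⊤` on `[0,b]`,
`v ≤ C` beyond `b` (measurable), `N ≥ 1`, `L > 0`. `≤` is monotonicity; for `≥`, near-minimisers `Φₙ` of
`v ⊓ n` have `(v ⊓ 0)`-energies `≤ sup + 1`, so a subsequence converges in `L²` to a measurable `Ψ`
(`stub_compactness`) with `q̄_{v⊓m}[Ψ] ≤ liminf energy_{v⊓m}(Φ_{φ k}) ≤ sup` for every `m`, hence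
`E₀(v) ≤ q̄_v[Ψ] ≤ sup` by the closed-form truncation `stub_closedEnergyTruncHardCore` (fed with its three
landed pieces `stub_coreCutoff`, `stub_shellMassOfCutoff`, `stub_layerKineticVanishing`).
[cite: Kato1966, VI §1.3 Thm 1.16] -/
theorem groundStateEnergy_trunc_iSup_hardCore :
    ∀ (N : ℕ) (v : ℝ → ℝ≥0∞) (L b : ℝ) (C : ℝ≥0) (hN : 1 ≤ N) (hL : 0 < L) (hb : 0 < b) (hv :
    Measurable v) (hcore : ∀ s : ℝ, s ∈ Set.Icc 0 b → v s = ⊤) (htail : ∀ s : ℝ, b < s → v s ≤ C), ⨆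
    n : ℕ, groundStateEnergy (fun r => min (v r) (n : ℝ≥0∞)) N L = groundStateEnergy v N L := by
  intro N v L b C hN hL hb hv hcore htail
  apply le_antisymm
  · exact iSup_le fun n => EnergyTrunc.groundStateEnergy_mono (fun r => min_le_left _ _) N L
  · set Einf : ℝ≥0∞ := ⨆ n : ℕ, groundStateEnergy (fun r => min (v r) (n : ℝ≥0∞)) N L with hEinf
    rcases eq_or_ne Einf ⊤ with htop | htop
    · rw [htop]; exact le_top
    have hEn : ∀ n : ℕ, groundStateEnergy (fun r => min (v r) (n : ℝ≥0∞)) N L ≤ Einf := fun n =>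
      le_iSup (fun n : ℕ => groundStateEnergy (fun r => min (v r) (n : ℝ≥0∞)) N L) n
    have hex : ∀ n : ℕ, ∃ Φ : TrialState N L,
        energy (fun r => min (v r) (n : ℝ≥0∞)) Φ ≤ Einf + ((n : ℝ≥0∞) + 1)⁻¹ := by
      intro n
      have hpos : (0 : ℝ≥0∞) < ((n : ℝ≥0∞) + 1)⁻¹ := ENNReal.inv_pos.2 (by simp)
      have hlt : groundStateEnergy (fun r => min (v r) (n : ℝ≥0∞)) N L <
          Einf + ((n : ℝ≥0∞) + 1)⁻¹ := (hEn n).trans_lt (ENNReal.lt_add_right htop hpos.ne')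
      obtain ⟨Φ, hΦ⟩ := iInf_lt_iff.1 hlt
      exact ⟨Φ, hΦ.le⟩
    choose Φ hΦ using hex
    have hE0 : ∀ n, energy (fun r => min (v r) ((0 : ℕ) : ℝ≥0∞)) (Φ n) ≤ Einf + 1 := by
      intro n
      refine (energy_trunc_mono v (Nat.zero_le n) (Φ n)).trans ((hΦ n).trans ?_)
      gcongr
      exact ENNReal.inv_le_one.2 (by simp)
    have hE1 : Einf + 1 ≠ ⊤ := ENNReal.add_ne_top.2 ⟨htop, ENNReal.one_ne_top⟩
    obtain ⟨Ψ, φ, hφ, hΨm, -, -, hT⟩ := stub_compactness N L _ (Einf + 1) Φ hE1 hE0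
    have hcm : ∀ m : ℕ, closedEnergy (fun r => min (v r) (m : ℝ≥0∞)) L Ψ ≤ Einf := by
      intro m
      refine (closedEnergy_le_liminf _ hT).trans ?_
      have hφt : Tendsto φ atTop atTop := hφ.tendsto_atTop
      have hg : Tendsto (fun k : ℕ => Einf + (((φ k : ℕ) : ℝ≥0∞) + 1)⁻¹) atTop (𝓝 Einf) := by
        have h1 : Tendsto (fun k : ℕ => (((φ k : ℕ) : ℝ≥0∞) + 1)⁻¹) atTop (𝓝 0) := by
          have h2 : Tendsto (fun n : ℕ => ((n : ℝ≥0∞) + 1)⁻¹) atTop (𝓝 0) := by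
            have := ENNReal.tendsto_inv_nat_nhds_zero.comp (tendsto_add_atTop_nat 1)
            refine this.congr fun n => ?_
            simp [Function.comp]
          exact h2.comp hφt
        simpa using tendsto_const_nhds.add h1
      rw [← hg.liminf_eq]
      refine liminf_le_liminf ?_
      filter_upwards [hφt.eventually_ge_atTop m] with k hk
      exact (energy_trunc_mono v hk _).trans (hΦ (φ k))
    have hsup : (⨆ m : ℕ, closedEnergy (fun r => min (v r) (m : ℝ≥0∞)) L Ψ) ≤ Einf := iSup_le hcm
    exact (groundStateEnergy_le_closedEnergy v L Ψ).trans
      ((stub_closedEnergyTruncHardCore stub_coreCutoff stub_shellMassOfCutoff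
        stub_layerKineticVanishing N v L b C hN hL hb hv hcore htail Ψ hΨm).trans hsup)

/-- **Uniqueness for the hard-core class on a CONNECTED free region** (component-wise Perron–Frobenius,
assembled from Stubs 0, 5b, 6, 14–20 of line `Sketch`): for `v = ⊤` on `[0,b]`, `v ≤ C` beyond `b`,
`N ≥ 1`, `L > 0`, `E₀ < ⊤`, and a path-connected free region `{all pairs > b} ∩ Λ_L^N`, the closed-form
ground state is unique up to phase. [cite: ReedSimonIV1978, §XIII.12 Thms XIII.44–47] -/
theorem hasUniqueGroundState_hardCore_of_joined :
    ∀ (hpos : (∀ (N : ℕ) (L b : ℝ), 0 < L → 0 ≤ b → ∀ (k : ℕ) (Z : ℕ → Config N) (m : ℝ), 0 < k → 0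
    < m → (∀ l : ℕ, l ≤ k → Z l ∈ boxN N L) → (∀ l : ℕ, l < k → ∀ θ : ℝ, θ ∈ Set.Icc (0 : ℝ) 1 → ∀ i
    j : Fin N, i ≠ j → b + 2 * m ≤ ‖(1 - θ) • (Z l i - Z l j) + θ • (Z (l + 1) i - Z (l + 1) j)‖) →
    ∀ A : Set (Config N), MeasurableSet A → (∀ δ : ℝ, 0 < δ → 0 < volume (A ∩ {W : Config N | ∀ i c,
    |W i c - Z k i c| < δ})) → ∀ C : ℝ≥0, ∃ c : ℝ, 0 < c ∧ ∃ δ₀ : ℝ, 0 < δ₀ ∧ ∀ w : ℝ → ℝ≥0∞,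
    Measurable w → (∀ s : ℝ, b + m ≤ s → w s ≤ C) → ∀ Y' : Config N, (∀ i c, |Y' i c - Z 0 i c| ≤
    δ₀) → c ≤ ((fkReal w L 1)^[k]) (A.indicator fun _ => (1 : ℝ)) Y') → ∀ (N : ℕ) (v : ℝ → ℝ≥0∞) (L
    b : ℝ) (C : ℝ≥0), 1 ≤ N → 0 < L → 0 < b → Measurable v → (∀ s : ℝ, s ∈ Set.Icc 0 b → v s = ⊤) →
    (∀ s : ℝ, b < s → v s ≤ C) → (⨆ n : ℕ, groundStateEnergy (fun r => min (v r) (n : ℝ≥0∞)) N L =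
    groundStateEnergy v N L) → ∀ S : Set (Config N), MeasurableSet S → S ⊆ {Z : Config N | Z ∈ boxN
    N L ∧ ∀ i j : Fin N, i ≠ j → b < dist (Z i) (Z j)} → (∀ X ∈ S, ∀ Y ∈ S, ∃ (k : ℕ) (Z : ℕ →
    Config N) (m : ℝ), Z 0 = X ∧ Z k = Y ∧ 0 < m ∧ (∀ l : ℕ, l ≤ k → Z l ∈ boxN N L) ∧ ∀ l : ℕ, l <
    k → ∀ θ : ℝ, θ ∈ Set.Icc (0 : ℝ) 1 → ∀ i j : Fin N, i ≠ j → b + 2 * m ≤ ‖(1 - θ) • (Z l i - Z l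
    j) + θ • (Z (l + 1) i - Z (l + 1) j)‖) → (∀ Ψ : Config N → ℂ, IsGroundState v L Ψ → ∀ᵐ X :
    Config N, X ∉ S → Ψ X = 0) → ∀ Ψ₀ : Config N → ℝ, (∀ X, 0 ≤ Ψ₀ X) → IsGroundState v L (fun X =>
    (Ψ₀ X : ℂ)) → ∀ᵐ X : Config N, X ∈ S → 0 < Ψ₀ X) (N : ℕ) (v : ℝ → ℝ≥0∞) (L b : ℝ) (C : ℝ≥0) (hN
    : 1 ≤ N) (hL : 0 < L) (hb : 0 < b) (hv : Measurable v) (hcore : ∀ s : ℝ, s ∈ Set.Icc 0 b → v s =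
    ⊤) (htail : ∀ s : ℝ, b < s → v s ≤ C) (hconn : ∀ X ∈ {Z : Config N | Z ∈ boxN N L ∧ ∀ i j : Fin
    N, i ≠ j → b < dist (Z i) (Z j)}, ∀ Y ∈ {Z : Config N | Z ∈ boxN N L ∧ ∀ i j : Fin N, i ≠ j → b
    < dist (Z i) (Z j)}, JoinedIn {Z : Config N | Z ∈ boxN N L ∧ ∀ i j : Fin N, i ≠ j → b < dist (Z
    i) (Z j)} X Y) (hE : groundStateEnergy v N L ≠ ⊤), HasUniqueGroundState v N L := by
  intro hpos N v L b C hN hL hb hv hcore htail hconn hE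
  have hSm : MeasurableSet
      {Z : Config N | Z ∈ boxN N L ∧ ∀ i j : Fin N, i ≠ j → b < dist (Z i) (Z j)} :=
    (isOpen_free N L b).measurableSet
  refine stub_uniqueOfPosOn stub_lincombGroundState N v L _ hSm
    (stub_existsNonnegGroundState stub_compactness N v L hE)
    (stub_vanishOffFree N v L b hb hcore) ?_
  intro Ψ₀ hΨ₀ hGS
  refine hpos (stub_chainedTube stub_localTubeCore) N v L b C hN hL hb hv hcore htail
    (groundStateEnergy_trunc_iSup_hardCore N v L b C hN hL hb hv hcore htail) _ hSm subset_rfl ?_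
    (stub_vanishOffFree N v L b hb hcore) Ψ₀ hΨ₀ hGS
  intro X hX Y hY
  exact stub_polygonalChain N L b X Y (hconn X hX Y hY)

/-- **Rigidity for the hard-core class on a connected free region** — the local form of the crux at
`(v, N, L)`: uniqueness (above) plus compactness give mutual `L²`-closeness of near-minimisers up to a
phase (`stub_rigidityOfUnique` fed with `stub_compactness`). [cite: ReedSimonIV1978, §XIII.12 Thm XIII.47] -/
theorem rigid_hardCore_of_joined :
    ∀ (hpos : (∀ (N : ℕ) (L b : ℝ), 0 < L → 0 ≤ b → ∀ (k : ℕ) (Z : ℕ → Config N) (m : ℝ), 0 < k → 0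
    < m → (∀ l : ℕ, l ≤ k → Z l ∈ boxN N L) → (∀ l : ℕ, l < k → ∀ θ : ℝ, θ ∈ Set.Icc (0 : ℝ) 1 → ∀ i
    j : Fin N, i ≠ j → b + 2 * m ≤ ‖(1 - θ) • (Z l i - Z l j) + θ • (Z (l + 1) i - Z (l + 1) j)‖) →
    ∀ A : Set (Config N), MeasurableSet A → (∀ δ : ℝ, 0 < δ → 0 < volume (A ∩ {W : Config N | ∀ i c,
    |W i c - Z k i c| < δ})) → ∀ C : ℝ≥0, ∃ c : ℝ, 0 < c ∧ ∃ δ₀ : ℝ, 0 < δ₀ ∧ ∀ w : ℝ → ℝ≥0∞,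
    Measurable w → (∀ s : ℝ, b + m ≤ s → w s ≤ C) → ∀ Y' : Config N, (∀ i c, |Y' i c - Z 0 i c| ≤
    δ₀) → c ≤ ((fkReal w L 1)^[k]) (A.indicator fun _ => (1 : ℝ)) Y') → ∀ (N : ℕ) (v : ℝ → ℝ≥0∞) (L
    b : ℝ) (C : ℝ≥0), 1 ≤ N → 0 < L → 0 < b → Measurable v → (∀ s : ℝ, s ∈ Set.Icc 0 b → v s = ⊤) →
    (∀ s : ℝ, b < s → v s ≤ C) → (⨆ n : ℕ, groundStateEnergy (fun r => min (v r) (n : ℝ≥0∞)) N L =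
    groundStateEnergy v N L) → ∀ S : Set (Config N), MeasurableSet S → S ⊆ {Z : Config N | Z ∈ boxN
    N L ∧ ∀ i j : Fin N, i ≠ j → b < dist (Z i) (Z j)} → (∀ X ∈ S, ∀ Y ∈ S, ∃ (k : ℕ) (Z : ℕ →
    Config N) (m : ℝ), Z 0 = X ∧ Z k = Y ∧ 0 < m ∧ (∀ l : ℕ, l ≤ k → Z l ∈ boxN N L) ∧ ∀ l : ℕ, l <
    k → ∀ θ : ℝ, θ ∈ Set.Icc (0 : ℝ) 1 → ∀ i j : Fin N, i ≠ j → b + 2 * m ≤ ‖(1 - θ) • (Z l i - Z l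
    j) + θ • (Z (l + 1) i - Z (l + 1) j)‖) → (∀ Ψ : Config N → ℂ, IsGroundState v L Ψ → ∀ᵐ X :
    Config N, X ∉ S → Ψ X = 0) → ∀ Ψ₀ : Config N → ℝ, (∀ X, 0 ≤ Ψ₀ X) → IsGroundState v L (fun X =>
    (Ψ₀ X : ℂ)) → ∀ᵐ X : Config N, X ∈ S → 0 < Ψ₀ X) (N : ℕ) (v : ℝ → ℝ≥0∞) (L b : ℝ) (C : ℝ≥0) (hN
    : 1 ≤ N) (hL : 0 < L) (hb : 0 < b) (hv : Measurable v) (hcore : ∀ s : ℝ, s ∈ Set.Icc 0 b → v s =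
    ⊤) (htail : ∀ s : ℝ, b < s → v s ≤ C) (hconn : ∀ X ∈ {Z : Config N | Z ∈ boxN N L ∧ ∀ i j : Fin
    N, i ≠ j → b < dist (Z i) (Z j)}, ∀ Y ∈ {Z : Config N | Z ∈ boxN N L ∧ ∀ i j : Fin N, i ≠ j → b
    < dist (Z i) (Z j)}, JoinedIn {Z : Config N | Z ∈ boxN N L ∧ ∀ i j : Fin N, i ≠ j → b < dist (Z
    i) (Z j)} X Y) (hE : groundStateEnergy v N L ≠ ⊤), ∀ η : ℝ, 0 < η → ∃ δ : ℝ≥0∞, 0 < δ ∧ ∀ Ψ Φ :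
    TrialState N L, energy v Ψ ≤ groundStateEnergy v N L + δ → energy v Φ ≤ groundStateEnergy v N L
    + δ → ∃ c : ℂ, ‖c‖ = 1 ∧ ∫⁻ X, (‖Ψ.ψ X - c * Φ.ψ X‖₊ : ℝ≥0∞) ^ 2 ≤ ENNReal.ofReal η := by
  intro hpos N v L b C hN hL hb hv hcore htail hconn hE
  exact stub_rigidityOfUnique stub_compactness v N L
    (hasUniqueGroundState_hardCore_of_joined hpos N v L b C hN hL hb hv hcore htail hconn hE)

/-- **The crux for the essential hard-core class, CONDITIONAL on dilute hard-sphere connectivity.**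
Hypothesis (Stub 21 `stub_cubeConnected` of line `Sketch`, OPEN — Baryshnikov–Bubenik–Kahle 2014 §6): an
absolute `c₀ > 0` such that for `N b³ ≤ c₀ L³` the free region `{all pairs > b} ∩ Λ_L^N` is path-connected
(with labels). Conclusion: for every admissible `v` with `v = ⊤` a.e. on `[0, b]` and `v ≤ C` a.e. on
`(b, ∞)` (`b > 0`), the statement of `GroundStateRigidity` at `v` with `ρ₀ = min (ρ₁(v), c₀/b³)`:
null sets of radii are invisible (`hasUniqueGroundState_iff_offNull`, `groundStateEnergy_congr_offNull`),
`E₀ < ⊤` eventually at `ρ < ρ₁(v)` (`stub_finiteEnergyLowDensity`), `N b³ ≤ c₀ L³` is `ρ b³ ≤ c₀`, and the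
two theorems above. [cite: ReedSimonIV1978, §XIII.12 Thm XIII.47] -/
theorem groundStateRigidity_hardCore_of_cubeConnected :
    ∀ (hpos : (∀ (N : ℕ) (L b : ℝ), 0 < L → 0 ≤ b → ∀ (k : ℕ) (Z : ℕ → Config N) (m : ℝ), 0 < k → 0
    < m → (∀ l : ℕ, l ≤ k → Z l ∈ boxN N L) → (∀ l : ℕ, l < k → ∀ θ : ℝ, θ ∈ Set.Icc (0 : ℝ) 1 → ∀ i
    j : Fin N, i ≠ j → b + 2 * m ≤ ‖(1 - θ) • (Z l i - Z l j) + θ • (Z (l + 1) i - Z (l + 1) j)‖) →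
    ∀ A : Set (Config N), MeasurableSet A → (∀ δ : ℝ, 0 < δ → 0 < volume (A ∩ {W : Config N | ∀ i c,
    |W i c - Z k i c| < δ})) → ∀ C : ℝ≥0, ∃ c : ℝ, 0 < c ∧ ∃ δ₀ : ℝ, 0 < δ₀ ∧ ∀ w : ℝ → ℝ≥0∞,
    Measurable w → (∀ s : ℝ, b + m ≤ s → w s ≤ C) → ∀ Y' : Config N, (∀ i c, |Y' i c - Z 0 i c| ≤
    δ₀) → c ≤ ((fkReal w L 1)^[k]) (A.indicator fun _ => (1 : ℝ)) Y') → ∀ (N : ℕ) (v : ℝ → ℝ≥0∞) (L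
    b : ℝ) (C : ℝ≥0), 1 ≤ N → 0 < L → 0 < b → Measurable v → (∀ s : ℝ, s ∈ Set.Icc 0 b → v s = ⊤) →
    (∀ s : ℝ, b < s → v s ≤ C) → (⨆ n : ℕ, groundStateEnergy (fun r => min (v r) (n : ℝ≥0∞)) N L =
    groundStateEnergy v N L) → ∀ S : Set (Config N), MeasurableSet S → S ⊆ {Z : Config N | Z ∈ boxN
    N L ∧ ∀ i j : Fin N, i ≠ j → b < dist (Z i) (Z j)} → (∀ X ∈ S, ∀ Y ∈ S, ∃ (k : ℕ) (Z : ℕ →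
    Config N) (m : ℝ), Z 0 = X ∧ Z k = Y ∧ 0 < m ∧ (∀ l : ℕ, l ≤ k → Z l ∈ boxN N L) ∧ ∀ l : ℕ, l <
    k → ∀ θ : ℝ, θ ∈ Set.Icc (0 : ℝ) 1 → ∀ i j : Fin N, i ≠ j → b + 2 * m ≤ ‖(1 - θ) • (Z l i - Z l
    j) + θ • (Z (l + 1) i - Z (l + 1) j)‖) → (∀ Ψ : Config N → ℂ, IsGroundState v L Ψ → ∀ᵐ X :
    Config N, X ∉ S → Ψ X = 0) → ∀ Ψ₀ : Config N → ℝ, (∀ X, 0 ≤ Ψ₀ X) → IsGroundState v L (fun X =>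
    (Ψ₀ X : ℂ)) → ∀ᵐ X : Config N, X ∈ S → 0 < Ψ₀ X) (hCC : ∃ c₀ : ℝ, 0 < c₀ ∧ ∀ (N : ℕ) (L b : ℝ),
    0 < b → (N : ℝ) * b ^ 3 ≤ c₀ * L ^ 3 → ∀ X ∈ {Z : Config N | Z ∈ boxN N L ∧ ∀ i j : Fin N, i ≠ j
    → b < dist (Z i) (Z j)}, ∀ Y ∈ {Z : Config N | Z ∈ boxN N L ∧ ∀ i j : Fin N, i ≠ j → b < dist (Z
    i) (Z j)}, JoinedIn {Z : Config N | Z ∈ boxN N L ∧ ∀ i j : Fin N, i ≠ j → b < dist (Z i) (Z j)}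
    X Y) (v : ℝ → ℝ≥0∞) (hv : IsRepulsiveFiniteRange v) (hHC : ∃ b : ℝ, 0 < b ∧ ∃ C : ℝ≥0, (∀ᵐ s :
    ℝ, s ∈ Set.Icc 0 b → v s = ⊤) ∧ (∀ᵐ s : ℝ, b < s → v s ≤ C)), ∃ ρ₀ : ℝ, 0 < ρ₀ ∧ ∀ ρ : ℝ, 0 < ρ
    → ρ < ρ₀ → ∀ᶠ N : ℕ in atTop, ∀ η : ℝ, 0 < η → ∃ δ : ℝ≥0∞, 0 < δ ∧ ∀ Ψ Φ : TrialState N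
    (sideLength ρ N), energy v Ψ ≤ groundStateEnergy v N (sideLength ρ N) + δ → energy v Φ ≤
    groundStateEnergy v N (sideLength ρ N) + δ → ∃ c : ℂ, ‖c‖ = 1 ∧ ∫⁻ X, (‖Ψ.ψ X - c * Φ.ψ X‖₊ :
    ℝ≥0∞) ^ 2 ≤ ENNReal.ofReal η := by
  intro hpos hCC v hv hHC
  obtain ⟨b, hb, C, hcoreae, htailae⟩ := hHC
  obtain ⟨c₀, hc₀, hconn⟩ := hCC
  obtain ⟨ρ₁, hρ₁, h₁⟩ := stub_finiteEnergyLowDensity v hv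
  classical
  -- a pointwise representative off a null set of radii
  set v' : ℝ → ℝ≥0∞ := fun s => if s ∈ Set.Icc 0 b then ⊤ else (if b < s then min (v s) C else v s)
    with hv'def
  set Sbad : Set ℝ := {s | s ∈ Set.Icc 0 b ∧ v s ≠ ⊤} ∪ {s | b < s ∧ (C : ℝ≥0∞) < v s} with hSbad
  have hSm : MeasurableSet Sbad := by
    refine MeasurableSet.union ?_ ?_
    · exact measurableSet_Icc.inter (hv.1 (measurableSet_singleton ⊤)).compl
    · exact (measurableSet_lt measurable_const measurable_id).inter
        (measurableSet_lt measurable_const hv.1)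
  have hS0 : volume Sbad = 0 := by
    rw [hSbad, measure_union_null_iff]
    constructor
    · rw [measure_eq_zero_iff_ae_notMem]
      filter_upwards [hcoreae] with s hs
      simp only [not_and, not_not]
      exact hs
    · rw [measure_eq_zero_iff_ae_notMem]
      filter_upwards [htailae] with s hs
      simp only [not_and, not_lt]
      exact hs
  have hvv' : ∀ r, r ∉ Sbad → v r = v' r := by
    intro r hr
    simp only [hSbad, Set.mem_union, Set.mem_setOf_eq, not_or, not_and, not_not, not_lt] at hr
    by_cases h1 : r ∈ Set.Icc 0 b
    · simp only [hv'def]; rw [if_pos h1]; exact hr.1 h1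
    · by_cases h2 : b < r
      · simp only [hv'def]; rw [if_neg h1, if_pos h2]; exact (min_eq_left (hr.2 h2)).symm
      · simp only [hv'def]; rw [if_neg h1, if_neg h2]
  have hv'm : Measurable v' := by
    refine Measurable.ite measurableSet_Icc measurable_const ?_
    exact Measurable.ite (measurableSet_lt measurable_const measurable_id)
      (hv.1.min measurable_const) hv.1
  have hcore' : ∀ s : ℝ, s ∈ Set.Icc 0 b → v' s = ⊤ := fun s hs => by
    simp only [hv'def]; rw [if_pos hs]
  have htail' : ∀ s : ℝ, b < s → v' s ≤ C := by
    intro s hs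
    have hs' : s ∉ Set.Icc 0 b := fun h => not_lt.2 h.2 hs
    simp only [hv'def]; rw [if_neg hs', if_pos hs]; exact min_le_right _ _
  refine ⟨min ρ₁ (c₀ / b ^ 3), lt_min hρ₁ (by positivity), fun ρ hρ hρm => ?_⟩
  filter_upwards [h₁ ρ hρ (hρm.trans_le (min_le_left _ _)), eventually_ge_atTop 1] with N hE hN
  have hL : 0 < sideLength ρ N := by
    unfold sideLength
    exact Real.rpow_pos_of_pos (div_pos (by exact_mod_cast hN) hρ) _
  have hE' : groundStateEnergy v' N (sideLength ρ N) ≠ ⊤ := by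
    rwa [← groundStateEnergy_congr_offNull hSm hS0 hvv' N (sideLength ρ N)]
  have hdens : (N : ℝ) * b ^ 3 ≤ c₀ * sideLength ρ N ^ 3 := by
    rw [Negative.sideLength_pow_three hρ (by omega)]
    have hρc : ρ < c₀ / b ^ 3 := hρm.trans_le (min_le_right _ _)
    have hb3 : 0 < b ^ 3 := by positivity
    have h1 : ρ * b ^ 3 ≤ c₀ := by
      rw [lt_div_iff₀ hb3] at hρc
      exact hρc.le
    have hNn : (0 : ℝ) ≤ N := by positivity
    calc (N : ℝ) * b ^ 3 = (N / ρ) * (ρ * b ^ 3) := by field_simp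
      _ ≤ (N / ρ) * c₀ := by gcongr
      _ = c₀ * (N / ρ) := by ring
  have hU : HasUniqueGroundState v N (sideLength ρ N) :=
    (hasUniqueGroundState_iff_offNull hSm hS0 hvv').2
      (hasUniqueGroundState_hardCore_of_joined hpos N v' (sideLength ρ N) b C hN hL hb hv'm hcore'
        htail' (hconn N (sideLength ρ N) b hb hdens) hE')
  intro η hη
  exact stub_rigidityOfUnique stub_compactness v N (sideLength ρ N) hU η hη

end Summit.AtomisticToContinuum.BoseEinsteinCondensation.Theorems.GroundStateRigidity

end
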